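import Literature.NumberTheory.PAdicHodge.TatePairingPointOfTeichLogRecognition
import Literature.NumberTheory.PAdicHodge.DualExpThetaReadingCoord
import Literature.NumberTheory.PAdicHodge.LegendreOfPeriodHoms
import HarnessLib

/-!
# Kato's explicit reciprocity law at a completion modulo the single membership (K₂)

Topic `Literature/NumberTheory/PAdicHodge`; THEOREMS ONLY (no definition, no named fact, no instance, no `sorry`). CAPSTONE of the
B₂-road of line `kato_lever` (crux K★ `stmt-BirchSwinnertonDyer-22226`), composing
`LegendreOfPeriodHoms.exists_legendre_of_periodHoms` (the Legendre relation with its `F^×`-constant, absorbed into `Pη`),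
`DualExpThetaReadingCoord.exists_thetaBdR_period_eq_expStarCoord_mul` (the Hodge–Tate reading of `exp*` WITH its coordinate) and
`TatePairingPointOfTeichLogRecognition.tatePairingPoint_eq_neg_trace_of_isTeichLog` (recognition from (K₂)):

★★★ `exists_const_tatePairingPoint_eq_neg_trace_of_KTwo` — at `F = K_v`, for `Γ_F`-equivariant `ℤ_p`-homogeneous period maps
`Pω ⊆ Fil¹` (`≢ 0`), `Pη ⊄ Fil¹` on `T_pW`, an alternating non-degenerate Weil tower, and the de Rham input of the tree
(`CupLogInjective`, `HasDualExp`, a `Fil⁰`-line `d`), **there is ONE constant `c ∈ F` such that for every cocycle `η`, every point `P`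
with Kummer cocycle `κ` and every integrating pair `(b_ω, b_η)` of `κ` with `θ(b_ω) = ι(c_P)`: IF the rescaled Legendre resolution
`p^N x̃(η σ)` lies in `X⁰₂` and is `p`-adically small near `1` ((K₂)), THEN `⟨[η], P⟩ = −Tr_{F/ℚ_p}(c_P · exp*_d(η) · c)`** —
Kato's Thm. 1.4.1 (4) shape `Tr(c · exp*_ω(a) · log_ω(b))` with `c_P = log_ω P` supplied by the K1 / θ-junction files
(`BdRPlusFormalLogBOmega`). Everything except (K₂) is a tree theorem; (K₂) is Kato's «`x ∈ X ⊗ V`» (crystalline content).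
BSD / K★ / [REC] are NOT proved by this file.

## References
* K. Kato, LNM 1553 (1993), Ch. II Thm. 1.4.1 (3)–(4), Prop. 1.2.3, Lemma 1.4.3–1.4.5. [Kato1993LNM1553]
* S. Bloch, K. Kato (1990), Ex. 3.10.1, Example 3.11. [BlochKato1990]
* P. Colmez, Math. Ann. 292 (1992), §2. [Colmez1992PeriodesAbeliennes]
-/

noncomputable section

open Field Function ValuativeRel WittVector NumberField IsDedekindDomain
open scoped NumberField Topology

namespace Literature.NumberTheory.PAdicHodge

open Literature.NumberTheory.GaloisRepresentations
open Literature.NumberTheory.GaloisRepresentations.IsNonarchimedeanLocalField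
open Literature.NumberTheory.GaloisCohomology
open Literature.NumberTheory.EllipticCurves
open Literature.NumberTheory.PAdicHodge.GaloisContinuity
open Literature.IUT.LogVolume
open _root_.WeierstrassCurve

section Completion

variable {K : Type} [Field K] [NumberField K] {p : ℕ} [hprime : Fact p.Prime] (v : HeightOneSpectrum (𝓞 K))
  [CharZero (v.adicCompletion K)] [LocallyCompactSpace (absoluteGaloisGroup (v.adicCompletion K))]
  [Fact (¬ IsUnit (p : integerC (v.adicCompletion K)))]
  [IsAdicComplete (Ideal.span {(p : integerC (v.adicCompletion K))}) (integerC (v.adicCompletion K))]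
  {K₀ : Type} [Field K₀] [CharZero K₀] (W : WeierstrassCurve K₀) [W.IsElliptic] [Algebra K₀ (v.adicCompletion K)]
  (e : (k : ℕ) → geomTorsion W ((p ^ k : ℕ) : ℤ) → geomTorsion W ((p ^ k : ℕ) : ℤ) → AlgebraicClosure K₀)
  (hμ : ∀ k S T, e k S T ^ (p ^ k) = 1) (hadd₁ : ∀ k S₁ S₂ T, e k (S₁ + S₂) T = e k S₁ T * e k S₂ T)
  (hadd₂ : ∀ k S T₁ T₂, e k S (T₁ + T₂) = e k S T₁ * e k S T₂)
  (hgal : ∀ k (σ : absoluteGaloisGroup K₀) (S T : geomTorsion W ((p ^ k : ℕ) : ℤ)), σ • e k S T = e k (σ • S) (σ • T))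
  (hcompat : ∀ k (S T : geomTorsion W ((p ^ (k + 1) : ℕ) : ℤ)),
    e k (torsionMulHom W (p ^ (k + 1)) (p ^ k) p (pow_succ p k).symm S)
      (torsionMulHom W (p ^ (k + 1)) (p ^ k) p (pow_succ p k).symm T) = e (k + 1) S T ^ p)

set_option maxHeartbeats 800000 in
include hgal in
/-- ★★★ **Kato's explicit reciprocity law at a completion, modulo (K₂).** See the module docstring: one constant `c ∈ F` (from
`Pω, Pη, e_∞, d`) such that for every `η`, `P` (Kummer cocycle `κ`), integrating pair `(b_ω, b_η)` with `θ(b_ω) = ι(c_P)`, the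
`X₂`-membership (K₂) of the RESCALED Legendre resolution (with the Legendre constant `c_L`: `Pη ↦ c_L⁻¹ Pη`, `b_η ↦ c_L⁻¹ b_η`) implies
`⟨[η], P⟩ = −Tr_{F/ℚ_p}(c_P · (exp*_d(η) · c))`. [cite: Kato1993LNM1553, Ch. II Thm. 1.4.1 (3)–(4), Prop. 1.2.3, Lemma 1.4.3]
[cite: BlochKato1990, Example 3.11] [cite: Colmez1992PeriodesAbeliennes, §2] -/
theorem exists_const_tatePairingPoint_eq_neg_trace_of_KTwo
    (hpv : valuation (v.adicCompletion K) (p : v.adicCompletion K) < 1)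
    (hF : Function.Surjective (fontaineTheta (integerC (v.adicCompletion K)) p))
    (ψ : C(absoluteGaloisGroup (v.adicCompletion K), ℤ_[p])) (hψ : ∀ σ τ, ψ (σ * τ) = ψ σ + ψ τ)
    (hψlog : ∀ τ, (ψ τ : ℚ_[p]) = logCyclotomic (F := v.adicCompletion K) p τ)
    {Pω Pη : W.tateModule p →+ BdRPlusTop (v.adicCompletion K) p}
    (hPωZ : ∀ (c : ℤ_[p]) (a : W.tateModule p), Pω (c • a) = BdRPlusTop.of (v.adicCompletion K) p (qpToBdR (c : ℚ_[p])) * Pω a)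
    (hPηZ : ∀ (c : ℤ_[p]) (a : W.tateModule p), Pη (c • a) = BdRPlusTop.of (v.adicCompletion K) p (qpToBdR (c : ℚ_[p])) * Pη a)
    (hPω : ∀ (σ : absoluteGaloisGroup (v.adicCompletion K)) (a : W.tateModule p),
      BdRPlusTop.gal (v.adicCompletion K) p σ (Pω a) = Pω (restrictedTateRep W (v.adicCompletion K) p σ a))
    (hPη : ∀ (σ : absoluteGaloisGroup (v.adicCompletion K)) (a : W.tateModule p),
      BdRPlusTop.gal (v.adicCompletion K) p σ (Pη a) = Pη (restrictedTateRep W (v.adicCompletion K) p σ a))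
    (hfil : ∀ a, Pω a ∈ (BdRPlusTop.filOne (v.adicCompletion K) p).toIdeal) (hne : ∃ a, Pω a ≠ 0)
    (hnot : ∃ a, Pη a ∉ (BdRPlusTop.filOne (v.adicCompletion K) p).toIdeal)
    (heL : ∀ (c : ℤ_[p]) (S U : W.tateModule p), (weilContPairingPadic W (v.adicCompletion K) p e hμ hadd₁ hadd₂ hgal hcompat).toLin (c • S) U =
      twistHom (v.adicCompletion K) p ((weilContPairingPadic W (v.adicCompletion K) p e hμ hadd₁ hadd₂ hgal hcompat).toLin S U) c)
    (healt : ∀ S : W.tateModule p, (weilContPairingPadic W (v.adicCompletion K) p e hμ hadd₁ hadd₂ hgal hcompat).toLin S S = 0)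
    (henondeg : ∀ S : W.tateModule p,
      (∀ U, (weilContPairingPadic W (v.adicCompletion K) p e hμ hadd₁ hadd₂ hgal hcompat).toLin S U = 0) → S = 0)
    (hinj : letI := LocalField.padicAlgebra (v.adicCompletion K) p hpv
      (bdRPeriodRingData (F := v.adicCompletion K) (p := p) hpv).CupLogInjective (logCyclotomic p) (restrictedRationalTateRep W (v.adicCompletion K) p))
    (hde : letI := LocalField.padicAlgebra (v.adicCompletion K) p hpv
      ∀ η : contOneCocycles (restrictedTateRep W (v.adicCompletion K) p).toTopRep,
        (bdRPeriodRingData (F := v.adicCompletion K) (p := p) hpv).HasDualExp (logCyclotomic p) (restrictedRationalTateRep W (v.adicCompletion K) p)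
          fun σ => TateModule.toRational p (η.1 σ))
    (d : letI := LocalField.padicAlgebra (v.adicCompletion K) p hpv
      (bdRPeriodRingData (F := v.adicCompletion K) (p := p) hpv).FilZeroLine (restrictedRationalTateRep W (v.adicCompletion K) p)) :
    letI := LocalField.padicAlgebra (v.adicCompletion K) p hpv
    ∃ (cL c : v.adicCompletion K), cL ≠ 0 ∧
      (∀ S U : W.tateModule p, Pω S * Pη U - Pη S * Pω U = BdRPlusTop.of (v.adicCompletion K) p (embBdRHom hpv hF cL) *
        BdRPlusTop.periodLine (v.adicCompletion K) p ((weilContPairingPadic W (v.adicCompletion K) p e hμ hadd₁ hadd₂ hgal hcompat).toLin S U)) ∧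
      ∀ (η κ : contOneCocycles (restrictedTateRep W (v.adicCompletion K) p).toTopRep) (P : (W.baseChange (v.adicCompletion K)).toAffine.Point),
        (∀ j, (cohomologyMap (tateProjMor W (v.adicCompletion K) p j) 1).hom (oneCocycleClass _ κ) = kummerLevelClass W (v.adicCompletion K) p j P) →
        ∀ (bω bη : BdRPlusTop (v.adicCompletion K) p) (cP : v.adicCompletion K),
          (∀ τ, Pω (κ.1 τ) = BdRPlusTop.gal (v.adicCompletion K) p τ bω - bω) → (∀ τ, Pη (κ.1 τ) = BdRPlusTop.gal (v.adicCompletion K) p τ bη - bη) →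
          thetaBdR ((BdRPlusTop.of (v.adicCompletion K) p).symm bω) = algebraMap (v.adicCompletion K) (CompletedAlgClosure (v.adicCompletion K)) cP →
          ∀ N : ℕ,
            (∀ σ, IsTeichLog 2 ((BdRPlusTop.of (v.adicCompletion K) p).symm ((p : BdRPlusTop (v.adicCompletion K) p) ^ N *
              (BdRPlusTop.of (v.adicCompletion K) p (embBdRHom hpv hF cL⁻¹) * Pη (η.1 σ) * bω -
                Pω (η.1 σ) * (BdRPlusTop.of (v.adicCompletion K) p (embBdRHom hpv hF cL⁻¹) * bη))))) →
            (∀ M' : ℕ, ∀ᶠ σ in 𝓝 (1 : absoluteGaloisGroup (v.adicCompletion K)), ∃ L' : BDeRhamPlus (integerC (v.adicCompletion K)) p, IsTeichLog 2 L' ∧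
              (BdRPlusTop.of (v.adicCompletion K) p).symm ((p : BdRPlusTop (v.adicCompletion K) p) ^ N *
                (BdRPlusTop.of (v.adicCompletion K) p (embBdRHom hpv hF cL⁻¹) * Pη (η.1 σ) * bω -
                  Pω (η.1 σ) * (BdRPlusTop.of (v.adicCompletion K) p (embBdRHom hpv hF cL⁻¹) * bη))) -
                (p : BDeRhamPlus (integerC (v.adicCompletion K)) p) ^ M' * L' ∈ Ideal.span {(xiBdR : BDeRhamPlus (integerC (v.adicCompletion K)) p) ^ 2}) →
            ((tatePairingPoint W (v.adicCompletion K) p e hμ hadd₁ hadd₂ hgal hcompat (oneCocycleClass _ η) P : ℤ_[p]) : ℚ_[p]) =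
              -Algebra.trace ℚ_[p] (v.adicCompletion K) (cP * (expStarCoord W hpv d η * c)) := by
  letI := LocalField.padicAlgebra (v.adicCompletion K) p hpv
  have halg : ∀ c : ℚ_[p], algebraMap ℚ_[p] (v.adicCompletion K) c = LocalField.padicRingHom (v.adicCompletion K) p hpv c := fun _ => rfl
  -- the Legendre constant and the rescaled `Pη`
  obtain ⟨cL, hcL, hLeg⟩ := BdRPlusTop.exists_legendre_of_periodHoms hpv hF W e hμ hadd₁ hadd₂ hgal hcompat hPωZ hPηZ hPω hPη hfil
    hne hnot heL healt henondeg
  obtain ⟨r, hr⟩ : ∃ r : BdRPlusTop (v.adicCompletion K) p, r = BdRPlusTop.of (v.adicCompletion K) p (embBdRHom hpv hF cL⁻¹) :=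
    ⟨_, rfl⟩
  have hgr : ∀ σ, BdRPlusTop.gal (v.adicCompletion K) p σ r = r := fun σ => by
    rw [hr]; exact congrArg (BdRPlusTop.of (v.adicCompletion K) p) (galBdRPlus_embBdRHom hpv hF σ _)
  obtain ⟨Pη', hPη'app⟩ : ∃ Pη' : W.tateModule p →+ BdRPlusTop (v.adicCompletion K) p, ∀ a, Pη' a = r * Pη a :=
    ⟨(AddMonoidHom.mulLeft r).comp Pη, fun _ => rfl⟩
  have hPη'Z : ∀ (c : ℤ_[p]) (a : W.tateModule p), Pη' (c • a) = BdRPlusTop.of (v.adicCompletion K) p (qpToBdR (c : ℚ_[p])) * Pη' a :=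
    fun c a => by rw [hPη'app, hPη'app, hPηZ, mul_left_comm]
  have hPη' : ∀ (σ : absoluteGaloisGroup (v.adicCompletion K)) (a : W.tateModule p),
      BdRPlusTop.gal (v.adicCompletion K) p σ (Pη' a) = Pη' (restrictedTateRep W (v.adicCompletion K) p σ a) := fun σ a => by
    rw [hPη'app, hPη'app, map_mul, hgr, hPη]
  have hrc : r * BdRPlusTop.of (v.adicCompletion K) p (embBdRHom hpv hF cL) = 1 := by
    rw [hr, ← map_mul, ← map_mul, inv_mul_cancel₀ hcL, map_one, map_one]
  have hLeg' : ∀ S U : W.tateModule p, Pω S * Pη' U - Pη' S * Pω U =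
      BdRPlusTop.periodLine (v.adicCompletion K) p ((weilContPairingPadic W (v.adicCompletion K) p e hμ hadd₁ hadd₂ hgal hcompat).toLin S U) := fun S U => by
    rw [hPη'app, hPη'app]
    linear_combination r * hLeg S U + (BdRPlusTop.periodLine (v.adicCompletion K) p
      ((weilContPairingPadic W (v.adicCompletion K) p e hμ hadd₁ hadd₂ hgal hcompat).toLin S U)) * hrc
  -- the Hodge–Tate reading with its coordinate, for the rescaled `Pη`
  obtain ⟨c, hc⟩ := BdRPlusTop.exists_thetaBdR_period_eq_expStarCoord_mul hpv halg W hF Pη' hPη'Z hPη' ψ hψlog hinj hde d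
  refine ⟨cL, c, hcL, hLeg, fun η κ P hκ bω bη cP hbω hbη hθb N hX hXsmall => ?_⟩
  obtain ⟨m, hβ⟩ := hc η
  have hbη' : ∀ τ, Pη' (κ.1 τ) = BdRPlusTop.gal (v.adicCompletion K) p τ (r * bη) - r * bη := fun τ => by
    rw [hPη'app, hbη, map_mul, hgr]; ring
  have hX' : ∀ σ, IsTeichLog 2 ((BdRPlusTop.of (v.adicCompletion K) p).symm ((p : BdRPlusTop (v.adicCompletion K) p) ^ N *
      (Pη' (η.1 σ) * bω - Pω (η.1 σ) * (r * bη)))) := fun σ => by rw [hPη'app, hr]; exact hX σ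
  have hXsmall' : ∀ M' : ℕ, ∀ᶠ σ in 𝓝 (1 : absoluteGaloisGroup (v.adicCompletion K)), ∃ L' : BDeRhamPlus (integerC (v.adicCompletion K)) p, IsTeichLog 2 L' ∧
      (BdRPlusTop.of (v.adicCompletion K) p).symm ((p : BdRPlusTop (v.adicCompletion K) p) ^ N * (Pη' (η.1 σ) * bω - Pω (η.1 σ) * (r * bη))) -
        (p : BDeRhamPlus (integerC (v.adicCompletion K)) p) ^ M' * L' ∈ Ideal.span {(xiBdR : BDeRhamPlus (integerC (v.adicCompletion K)) p) ^ 2} := fun M' => by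
    filter_upwards [hXsmall M'] with σ hσ
    rw [hPη'app, hr]; exact hσ
  exact tatePairingPoint_eq_neg_trace_of_isTeichLog v W e hμ hadd₁ hadd₂ hgal hcompat hPω hPη' hLeg' hpv hF ψ hψ hψlog hfil η κ P hκ
    hbω hbη' hθb hβ hX' hXsmall'

end Completion

end Literature.NumberTheory.PAdicHodge

end
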